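import Mathlib
import Summits.ResolutionOfSingularities.ResolutionOfSingularities.Theorems.EquisingularLiftEquisingularLiftNatEquinodalNodeRegularCore
import Literature.AlgebraicGeometry.Resolution.RegularLocalRingsQuotient
import Literature.AlgebraicGeometry.Resolution.RegularLocalRingsProofs
import HarnessLib

/-!
# [OURS · L1 W4.5(b) · EL♮(3) · NOSE «EQUINODAL» W5b, named helper H1] A PAIR CUT OUT BY TWO DERIVATIONS IS A REGULAR QUOTIENT

res-type-027 g22 (helper hand of the W5b pen res-L1-w45b-stub-2 g18, «027: prove H1», STATUS 2026-08-29T02:22:09Z; desk g25-13).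
OURS; NOT a statement of any manuscript ([Hironaka2017] is a candidate under adjudication, nothing of it is asserted); AI-written, weaker
than expert review.  Pure commutative algebra, `import Mathlib` + named tree files; DEF-FREE; no `sorry`; standard axioms.
`--supports stmt-ResolutionOfSingularities-20148 --as helper`; W5b (`nose_regular_near_node`) imports it BY NAME.

WHAT.  `R` a commutative ring, `𝔭` a prime, `Rₚ = R_𝔭` regular local, `D₁ D₂ : Derivation ℤ R R`, `f g ∈ 𝔭` with
`D₁ f ∉ 𝔭`, `D₂ f ∈ 𝔭`, `D₂ g ∉ 𝔭` («the Jacobian of `(f, g)` w.r.t. `(D₁, D₂)` is triangular with unit diagonal mod `𝔭`»).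
THEN `Rₚ ⧸ (f, g)` is a regular local ring.

PROOF (entirely on the `R`-side; no extension of derivations to `Rₚ` is needed).
(1) `Rₚ ⧸ (f)` is regular: ✓ `NodeReg.isRegularLocalRing_quotient_of_derivation_not_mem 𝔭 D₁ hf h1f` (`f ∉ 𝔭⁽²⁾` because `D₁ f ∉ 𝔭`).
(2) the class `ḡ` of `g` lies in the maximal ideal `𝔪̄ = 𝔪·(Rₚ⧸(f))` and NOT in `𝔪̄²`: otherwise `φ g ∈ 𝔪² + (φ f)`, i.e.
    `φ g - q ∈ (φ f)` with `q ∈ 𝔪²`; clearing denominators, `φ (s₁ g + t f) ∈ 𝔪²` for some `s₁ ∉ 𝔭`, hence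
    (✓ `NodeReg.exists_mul_mem_sq_of_algebraMap_mem_sq`) `s₂ (s₁ g + t f) ∈ 𝔭²` with `s₂ ∉ 𝔭`, hence
    (✓ `NodeReg.derivation_mem_of_mul_mem_sq D₂`) `D₂ (s₁ g + t f) ∈ 𝔭`; Leibniz and `f, g, D₂ f ∈ 𝔭` give `s₁ · D₂ g ∈ 𝔭`,
    so `D₂ g ∈ 𝔭` — contradiction.
(3) Literature ✓ `IsRegularLocalRing.quotient_span_singleton` ([Matsumura1987, Thm. 14.2]) on `Rₚ ⧸ (f)` and the third
    isomorphism theorem `(Rₚ⧸(f))⧸(ḡ) ≃ Rₚ⧸(f, g)` (`DoubleQuot.quotQuotEquivQuotSup`).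
[cite: Matsumura1987, Thm. 14.2] [folklore]
-/

set_option linter.dupNamespace false -- mandated namespace `Summit.<Summit>.<Problem>` of this single-conjunct summit

noncomputable section

open IsLocalRing

namespace Summit.ResolutionOfSingularities.ResolutionOfSingularities.Cruxes.EquisingularLiftNat.Sections.Equinodal.NodeReg

/-- **(H1) TWO DERIVATIONS WITH TRIANGULAR JACOBIAN CUT A REGULAR QUOTIENT.**  `𝔭 ⊂ R` prime, `Rₚ = R_𝔭` a regular local
ring, `D₁ D₂ : Derivation ℤ R R`, `f g ∈ 𝔭` with `D₁ f ∉ 𝔭`, `D₂ f ∈ 𝔭`, `D₂ g ∉ 𝔭`; then `Rₚ ⧸ (f, g)` is a regular local ring.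
Proof: `Rₚ⧸(f)` is regular (✓ `isRegularLocalRing_quotient_of_derivation_not_mem` with `D₁`); the class of `g` is a regular
parameter of `Rₚ⧸(f)` — were `φ g ∈ 𝔪² + (φ f)`, clearing denominators and applying `D₂` (✓ `derivation_mem_of_mul_mem_sq`,
Leibniz, `D₂ f ∈ 𝔭`) would force `D₂ g ∈ 𝔭`; conclude by [Matsumura1987, Thm. 14.2] (Literature ✓
`IsRegularLocalRing.quotient_span_singleton`) and `(Rₚ⧸(f))⧸(ḡ) ≃ Rₚ⧸(f, g)`. [cite: Matsumura1987, Thm. 14.2]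
[OURS · L1 W4.5b · NOSE EQUINODAL W5b · helper H1] -/
theorem isRegularLocalRing_quotient_pair_of_derivations {R Rₚ : Type*} [CommRing R] [CommRing Rₚ] [Algebra R Rₚ]
    (𝔭 : Ideal R) [𝔭.IsPrime] [IsLocalization.AtPrime Rₚ 𝔭] [IsRegularLocalRing Rₚ] (D₁ D₂ : Derivation ℤ R R)
    {f g : R} (hf : f ∈ 𝔭) (hg : g ∈ 𝔭) (h1f : D₁ f ∉ 𝔭) (h2f : D₂ f ∈ 𝔭) (h2g : D₂ g ∉ 𝔭) :
    IsRegularLocalRing (Rₚ ⧸ Ideal.span {algebraMap R Rₚ f, algebraMap R Rₚ g}) := by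
  -- (1) `Rₚ ⧸ (f)` is a regular local ring
  obtain ⟨hreg₁, -⟩ := isRegularLocalRing_quotient_of_derivation_not_mem (Rₚ := Rₚ) 𝔭 D₁ hf h1f
  set I : Ideal Rₚ := Ideal.span {algebraMap R Rₚ f} with hI
  -- (2) the class of `g` is a regular parameter of `Rₚ ⧸ (f)`
  have hgm : algebraMap R Rₚ g ∈ maximalIdeal Rₚ := (IsLocalization.AtPrime.to_map_mem_maximal_iff Rₚ 𝔭 g).mpr hg
  have hmax : maximalIdeal (Rₚ ⧸ I) = (maximalIdeal Rₚ).map (Ideal.Quotient.mk I) :=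
    Literature.AlgebraicGeometry.Resolution.maximalIdeal_quotient_eq_map I
  have hgm₁ : Ideal.Quotient.mk I (algebraMap R Rₚ g) ∈ maximalIdeal (Rₚ ⧸ I) := by
    rw [hmax]; exact Ideal.mem_map_of_mem _ hgm
  have hg2₁ : Ideal.Quotient.mk I (algebraMap R Rₚ g) ∉ maximalIdeal (Rₚ ⧸ I) ^ 2 := by
    intro h
    rw [hmax, ← Ideal.map_pow, Ideal.mem_map_iff_of_surjective _ Ideal.Quotient.mk_surjective] at h
    obtain ⟨q, hq, hqg⟩ := h
    rw [Ideal.Quotient.eq, hI, Ideal.mem_span_singleton'] at hqg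
    obtain ⟨σ, hσ⟩ := hqg
    obtain ⟨⟨t, s₁⟩, hts⟩ := IsLocalization.mk'_surjective 𝔭.primeCompl σ
    -- clearing denominators: `φ (s₁ g + t f) = φ s₁ * q ∈ 𝔪²`
    have hkey : algebraMap R Rₚ ((s₁ : R) * g + t * f) ∈ maximalIdeal Rₚ ^ 2 := by
      have h1 : algebraMap R Rₚ ((s₁ : R) * g + t * f) = algebraMap R Rₚ (s₁ : R) * q := by
        have h2 : algebraMap R Rₚ (s₁ : R) * σ = algebraMap R Rₚ t := by
          rw [← hts, IsLocalization.mul_mk'_eq_mk'_of_mul, IsLocalization.mk'_mul_cancel_left]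
        have h3 : q = σ * algebraMap R Rₚ f + algebraMap R Rₚ g := by rw [hσ]; ring
        rw [map_add, map_mul, map_mul, h3, mul_add, ← mul_assoc, h2]; ring
      rw [h1]; exact Ideal.mul_mem_left _ _ hq
    obtain ⟨s₂, hs₂, hs₂G⟩ := exists_mul_mem_sq_of_algebraMap_mem_sq 𝔭 hkey
    have hG : (s₁ : R) * g + t * f ∈ 𝔭 := add_mem (Ideal.mul_mem_left _ _ hg) (Ideal.mul_mem_left _ _ hf)
    have hD := derivation_mem_of_mul_mem_sq D₂ hG hs₂ hs₂G
    rw [map_add, Derivation.leibniz, Derivation.leibniz, smul_eq_mul, smul_eq_mul, smul_eq_mul, smul_eq_mul,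
      add_assoc] at hD
    have hrest : g * D₂ (s₁ : R) + (t * D₂ f + f * D₂ t) ∈ 𝔭 :=
      add_mem (Ideal.mul_mem_right _ _ hg) (add_mem (Ideal.mul_mem_left _ _ h2f) (Ideal.mul_mem_right _ _ hf))
    have hs₁D : (s₁ : R) * D₂ g ∈ 𝔭 := (Ideal.add_mem_iff_left _ hrest).mp hD
    exact h2g (((Ideal.IsPrime.mem_or_mem ‹𝔭.IsPrime› hs₁D).resolve_left s₁.prop))
  -- (3) cut once more by the regular parameter `ḡ` and transport along `(Rₚ⧸(f))⧸(ḡ) ≃ Rₚ⧸(f, g)`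
  obtain ⟨hreg₂, -⟩ :=
    Literature.AlgebraicGeometry.Resolution.IsRegularLocalRing.quotient_span_singleton hgm₁ hg2₁
  have hspan : Ideal.span {Ideal.Quotient.mk I (algebraMap R Rₚ g)} =
      (Ideal.span {algebraMap R Rₚ g}).map (Ideal.Quotient.mk I) := by
    rw [Ideal.map_span, Set.image_singleton]
  have hsup : I ⊔ Ideal.span {algebraMap R Rₚ g} = Ideal.span {algebraMap R Rₚ f, algebraMap R Rₚ g} := by
    rw [hI, ← Ideal.span_insert]
  exact IsRegularLocalRing.of_ringEquiv
    ((Ideal.quotEquivOfEq hspan).trans ((DoubleQuot.quotQuotEquivQuotSup _ _).trans (Ideal.quotEquivOfEq hsup)))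

end Summit.ResolutionOfSingularities.ResolutionOfSingularities.Cruxes.EquisingularLiftNat.Sections.Equinodal.NodeReg

end
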